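import Summits.BirchSwinnertonDyer.BirchSwinnertonDyer.Theorems.PrintCf2RamifiedOffTYZSelmerRankOneMover
import Literature.NumberTheory.EllipticCurves.Wuthrich2014.ShaBoundProofs
import Literature.NumberTheory.EllipticCurves.CongruentNumberMonskySelmerParitySelmer
import HarnessLib

/-!
# Crux `PrintCf2.RamifiedOffTYZOfFacts` (stmt-BirchSwinnertonDyer-20509), line `offtyz-v7`, LEAD cycle 8 (cruxlead-20509 g7):
# THE `s = 1` STRATUM FOR `n ≡ 5 (mod 8)` FROM THE PER-`n` DISPLAYS — enumeration-free form (any square-free `n`, prime tuple supplied inside),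
# the displays `GenusPointData.Printed` and the unfolded `CMPointRingClassFrobeniusPrinted`, and isogeny saturation

THEOREMS ONLY (no `def`, no `sorry`), `--supports stmt-BirchSwinnertonDyer-20509`.  This file restates `rankOne_sha_bsdp_two_of_card_selmer_eight`
(`…SelmerRankOneMover`) for an arbitrary square-free `n ≡ 5 (mod 8)` (prime tuple from `MonskySelmerParity.exists_odd_prime_family_of_squarefree`)
with the hypotheses in DISPLAY SHAPE: `hPr : D.Printed` and `hCM` = the body of `GenusPointData.CMPointRingClassFrobeniusPrinted D`
(`Literature/…/TianYuanZhang2017/CMPointFrobeniusDisplays.lean`, p691528) UNFOLDED — the existential package of the CM-point layer, the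
conductor-`2`/`4` ring class dictionaries and the Frobenius clause — so that the by-name corollary from the named fact
`tyz_cmPointRingClassFrobeniusData` is a one-line `obtain`/`exact` (sequel file, once the farm has built the new Literature module).
§2 adds ISOGENY SATURATION with conjuncts 1–3 of the route's bundle 𝔅_ram (GZK, entire `L`, Cassels), as p650357 did for the jump-one class.
BSD is not proved by any of this; no route item is closed by this file (helper toward 23432/20509).

References: [cite: TianYuanZhang2017, Thm. 1.1, §3 (Prop. 3.2 (1)(2), Prop. 3.4, Thm. 3.5, Thm. 3.6, Lemma 3.18, Lemma 3.21)];
[cite: HeathBrown1994SelmerCongruentII, Appendix (Monsky)]; [cite: Smith2016CongruentDensity, Thm. 1.4]; [cite: Cox2013, §5.C Lemma 5.19, (5.22), §9.A];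
[cite: MilneADT2006, Thm. I.7.3]; [cite: Miller2011LMS, Def. 1.1].
-/

noncomputable section

open scoped Classical

open WeierstrassCurve WeierstrassCurve.Affine Finset Literature.NumberTheory.EllipticCurves
  Literature.NumberTheory.EllipticCurves.TianYuanZhang2017
  Literature.NumberTheory.EllipticCurves.MonskySelmerParity
  Literature.NumberTheory.EllipticCurves.Rank1Residual
  Literature.NumberTheory.QuadraticFields.RingClass

set_option autoImplicit false

namespace Summit.BirchSwinnertonDyer.PrintCf2.MoverAssembly

/-! ## §1 From the per-`n` displays (Frobenius package unfolded) -/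

/-- **THE `s = 1` STRATUM FOR A SQUARE-FREE `n ≡ 5 (mod 8)`, display shape.**  For square-free `n ≡ 5 (mod 8)` with `#Sel⁽²⁾(E_n/ℚ) = 8`, data
`D : GenusPointData n` with `D.Printed`, the CM-point / ring-class / Frobenius package (the body of `CMPointRingClassFrobeniusPrinted D`), and TYZ
Thm 1.1: `ord_{s=1} L(E_n,s) = 1`, `rank E_n(ℚ) = 1`, `Ш(E_n)[2^∞] = 0`, `BSD(E_n, 2)`.
[cite: TianYuanZhang2017, Thm. 1.1 and §3 (Prop. 3.2 (1), Thm. 3.5, Thm. 3.6 (1), Lemma 3.18, proof of Lemma 3.21)]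
[cite: HeathBrown1994SelmerCongruentII, Appendix (Monsky), typescript p. 39 L10–L41] [cite: Cox2013, §5.C Lemma 5.19, (5.22), §9.A] [cite: Miller2011LMS, Def. 1.1] -/
theorem rankOne_sha_bsdp_two_of_selmerEight_of_displays {n : ℕ} (hsq : Squarefree n) (h5 : n % 8 = 5)
    (D : GenusPointData n) (hPr : D.Printed)
    (hCM : ∃ (z : ℕ → APoint D.H) (Φ : ℕ → Finset (D.H ≃ₐ[ℚ] D.H)) (ΓH ΓH' : ℕ → Subgroup (D.H ≃ₐ[ℚ] D.H))
      (σ θ : ℕ → (D.H ≃ₐ[ℚ] D.H)) (c : D.H ≃ₐ[ℚ] D.H)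
      (ρ₂ : (d : ℕ) → (D.galK d →* RingClassGroup (GenusField d) 2))
      (ρ₄ : (d : ℕ) → (D.galK d →* RingClassGroup (GenusField d) 4)),
      D.ConjSpec c ∧
      ∀ d ∈ n.divisors,
        ((d % 8 = 5 ∨ d % 8 = 6) → D.CMBlockSpec d (z d) (Φ d) (ΓH d) (ΓH' d) (σ d) c) ∧
        (d % 8 = 6 → D.ThetaBlockSpec d (z d) (ΓH d) (ΓH' d) (σ d) (θ d)) ∧
        (d % 8 = 7 → D.SevenBlockSpec d) ∧
        (d % 8 = 5 → D.RingClassTwoBlockSpec d (ΓH d) (ΓH' d) (ρ₂ d)) ∧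
        (d % 8 = 6 → D.RingClassFourBlockSpec d (ΓH d) (ΓH' d) (ρ₄ d)) ∧
        (d % 8 = 5 → ∀ q : ℕ, q.Prime → q ∣ d → ∃ φ : D.H ≃ₐ[ℚ] D.H,
          φ (D.sqrtNeg d) = D.sqrtNeg d ∧ φ * φ ∈ ΓH' d ∧ φ D.im = (jacobiSym (-1) q) • D.im ∧
            ∀ r : ℕ, r.Prime → r ∣ n → r ≠ q → φ (D.sqrtNeg r) = (jacobiSym (-(r : ℤ)) q) • D.sqrtNeg r))
    (h11 : thm11_parity_of_scriptL)
    (hsel : haveI := isElliptic_congruentNumberCurve hsq.ne_zero; Nat.card ((congruentNumberCurve n).selmerGroup 2) = 8) :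
    haveI := isElliptic_congruentNumberCurve hsq.ne_zero
    (congruentNumberCurve n).analyticRank = 1 ∧ (congruentNumberCurve n).mordellWeilRank = 1 ∧
      AddCommGroup.primaryComponent (congruentNumberCurve n).sha 2 = ⊥ ∧ BSDp (congruentNumberCurve n) 2 := by
  have hodd : Odd n := Nat.odd_iff.mpr (by omega)
  obtain ⟨k, p, hp, hp2, hinj, hprod⟩ := exists_odd_prime_family_of_squarefree hsq hodd
  have hpodd : ∀ i, Odd (p i) := fun i => (hp i).odd_of_ne_two (hp2 i)
  obtain ⟨z, Φ, ΓH, ΓH', σ, θ, c, ρ₂, ρ₄, hc, hall⟩ := hCM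
  obtain ⟨hLs, -, hrec, -, h35, -, -, -, h318, -, -⟩ := hPr
  exact rankOne_sha_bsdp_two_of_card_selmer_eight p hp hpodd hinj D hprod.symm h5 hrec h35 hLs h318 z Φ ΓH ΓH' σ c ρ₂ hc
    (fun d hd => ⟨(hall d hd).1, (hall d hd).2.2.1⟩) (fun d hd h5d => (hall d hd).2.2.2.1 h5d)
    (fun d hd h5d => (hall d hd).2.2.2.2.2 h5d) h11 hsel

/-! ## §2 Isogeny saturation (conjuncts 1–3 of 𝔅_ram) -/

/-- **`BSD(W, 2)` for every globally minimal `W/ℚ` isogenous to a minimal-Selmer `E_n`, `n ≡ 5 (mod 8)`** (display shape), granted GZK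
(`rank_eq_analyticRank_of_analyticRank_le_one`, finiteness of `Ш(E_n)`), `hasEntireLFunction_rat` and Cassels' invariance `bsdRHS_eq_of_isIsogenous`
(conjuncts 1–3 of the route's bundle): `r_an(E_n) = 1`, `BSD(E_n, 2)` by §1, transport by `Wuthrich2014.bsdp_of_isIsogenous`.
[cite: MilneADT2006, Thm. I.7.3] [cite: TianYuanZhang2017, Thm. 1.1 and §3] [cite: Miller2011LMS, Def. 1.1] -/
theorem bsdp_two_of_isIsogenous_selmerEight_of_displays
    (hGZK : rank_eq_analyticRank_of_analyticRank_le_one) (hL : hasEntireLFunction_rat) (hCassels : bsdRHS_eq_of_isIsogenous)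
    {W : WeierstrassCurve ℚ} [W.IsElliptic] [W.IsGloballyMinimal]
    {n : ℕ} (hsq : Squarefree n) (h5 : n % 8 = 5)
    (D : GenusPointData n) (hPr : D.Printed)
    (hCM : ∃ (z : ℕ → APoint D.H) (Φ : ℕ → Finset (D.H ≃ₐ[ℚ] D.H)) (ΓH ΓH' : ℕ → Subgroup (D.H ≃ₐ[ℚ] D.H))
      (σ θ : ℕ → (D.H ≃ₐ[ℚ] D.H)) (c : D.H ≃ₐ[ℚ] D.H)
      (ρ₂ : (d : ℕ) → (D.galK d →* RingClassGroup (GenusField d) 2))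
      (ρ₄ : (d : ℕ) → (D.galK d →* RingClassGroup (GenusField d) 4)),
      D.ConjSpec c ∧
      ∀ d ∈ n.divisors,
        ((d % 8 = 5 ∨ d % 8 = 6) → D.CMBlockSpec d (z d) (Φ d) (ΓH d) (ΓH' d) (σ d) c) ∧
        (d % 8 = 6 → D.ThetaBlockSpec d (z d) (ΓH d) (ΓH' d) (σ d) (θ d)) ∧
        (d % 8 = 7 → D.SevenBlockSpec d) ∧
        (d % 8 = 5 → D.RingClassTwoBlockSpec d (ΓH d) (ΓH' d) (ρ₂ d)) ∧
        (d % 8 = 6 → D.RingClassFourBlockSpec d (ΓH d) (ΓH' d) (ρ₄ d)) ∧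
        (d % 8 = 5 → ∀ q : ℕ, q.Prime → q ∣ d → ∃ φ : D.H ≃ₐ[ℚ] D.H,
          φ (D.sqrtNeg d) = D.sqrtNeg d ∧ φ * φ ∈ ΓH' d ∧ φ D.im = (jacobiSym (-1) q) • D.im ∧
            ∀ r : ℕ, r.Prime → r ∣ n → r ≠ q → φ (D.sqrtNeg r) = (jacobiSym (-(r : ℤ)) q) • D.sqrtNeg r))
    (h11 : thm11_parity_of_scriptL)
    (hsel : haveI := isElliptic_congruentNumberCurve hsq.ne_zero; Nat.card ((congruentNumberCurve n).selmerGroup 2) = 8)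
    (hiso : IsIsogenous W (congruentNumberCurve n)) : BSDp W 2 := by
  haveI := isElliptic_congruentNumberCurve hsq.ne_zero
  haveI := isGloballyMinimal_congruentNumberCurve hsq
  obtain ⟨hr1, -, -, h₀⟩ := rankOne_sha_bsdp_two_of_selmerEight_of_displays hsq h5 D hPr hCM h11 hsel
  exact Wuthrich2014.bsdp_of_isIsogenous hCassels hiso (hGZK (congruentNumberCurve n) hr1.le).2
    ((congruentNumberCurve n).leadingLCoeff_ne_zero_holds (hL (congruentNumberCurve n))) h₀

end Summit.BirchSwinnertonDyer.PrintCf2.MoverAssembly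

end
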